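import Mathlib
import Summits.Ventures.PercRepro2.TB14Series

/-!
# Two auxiliary kernels for typed BHK 1.4: the antisymmetric spectator and the typed BHK 1.3 kernel
(blind cell PercRepro2, mine-c g17, 2026-08-25; `proofs/MINEC-TB14BLOCK.md` §11)

`foldK0 = 1_Q(y) 1_Q(w) (1[o ∈ C_w(a₂)] − 1[o ∈ C_y(a₂)])` is antisymmetric with vanishing diagonal, so its
two-copy count is `0` at every profile (`pairCount_foldK0`, via `pairCount_eq_zero_of_antisymm`: the
involution `y ↦ flipOn F y` pairs the summands off — valid over every field, no characteristic assumption).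
`foldK13 = 1_Q(y) 1_Q(w) 1[x ∈ C_y(a₂)] (1[o ∈ C_y(a₂)] − 1[o ∈ C_w(a₂)])` is the typed BHK 1.3 kernel of the
root `a₂` avoiding `a₁` for the single-vertex events `{x ∈ C₂}`, `{o ∈ C₂}`; its two-copy count is the
`(TB13)_sv` slack `N(Q ∩ A ∩ A', Q) − N(Q ∩ A, Q ∩ A')`.  Both are used by the sliding rule at the own root
(`TB14SlideOwn`) and by the equality-locus theorem (`TB14RootSep`).  Own work; standard axioms.
-/

namespace Summit.Ventures.PercRepro2

namespace TB14Cut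

open CovForm A3InactiveTyped

section Kernels

variable {V : Type} {E : Type} [Fintype E] [DecidableEq E] {R : Type*} [Field R]

/-- The antisymmetric spectator kernel `1_Q(y) 1_Q(w) (1[o ∈ C_w(a₂)] − 1[o ∈ C_y(a₂)])`. -/
noncomputable def foldK0 (ends : E → Sym2 V) (a₁ a₂ o : V) : Config E → Config E → R :=
  fun y w => iQ ends a₁ a₂ y * iQ ends a₁ a₂ w * (iH ends a₂ o w - iH ends a₂ o y)

/-- The typed BHK 1.3 kernel of the root `a₂` avoiding `a₁`, for the single-vertex events
`{x ∈ C₂}` and `{o ∈ C₂}`: `1_Q(y) 1_Q(w) 1[x ∈ C_y(a₂)] (1[o ∈ C_y(a₂)] − 1[o ∈ C_w(a₂)])`; its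
two-copy count is the `(TB13)_sv` slack `N(Q ∩ A ∩ A', Q) − N(Q ∩ A, Q ∩ A')`. -/
noncomputable def foldK13 (ends : E → Sym2 V) (a₁ a₂ x o : V) : Config E → Config E → R :=
  fun y w => iQ ends a₁ a₂ y * iQ ends a₁ a₂ w * iH ends a₂ x y * (iH ends a₂ o y - iH ends a₂ o w)

omit [Fintype E] [DecidableEq E] in
/-- `foldK0` is antisymmetric. -/
lemma foldK0_swap (ends : E → Sym2 V) (a₁ a₂ o : V) (y w : Config E) :
    (foldK0 ends a₁ a₂ o w y : R) = - foldK0 ends a₁ a₂ o y w := by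
  simp only [foldK0]; ring

omit [Fintype E] [DecidableEq E] in
/-- `foldK0` vanishes on the diagonal. -/
lemma foldK0_diag (ends : E → Sym2 V) (a₁ a₂ o : V) (y : Config E) :
    (foldK0 ends a₁ a₂ o y y : R) = 0 := by
  simp only [foldK0]; ring

/-- The two-copy count of an antisymmetric kernel with vanishing diagonal is `0` (the involution
`y ↦ flipOn F y` pairs the summands off). -/
lemma pairCount_eq_zero_of_antisymm (F : Finset E) (z : Config E)
    (Φ : Config E → Config E → R) (hswap : ∀ y w, Φ w y = - Φ y w) (hdiag : ∀ y, Φ y y = 0) :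
    pairCount F z Φ = 0 := by
  unfold pairCount
  have hagree : ∀ y : Config E, (∀ e, e ∉ F → A3InactiveTyped.flipOn F y e = z e) ↔
      (∀ e, e ∉ F → y e = z e) := by
    intro y
    constructor
    · intro h e he; rw [← A3InactiveTyped.flipOn_of_notMem (y := y) he]; exact h e he
    · intro h e he; rw [A3InactiveTyped.flipOn_of_notMem he]; exact h e he
  refine Finset.sum_involution (fun y _ => A3InactiveTyped.flipOn F y) ?_ ?_ ?_ ?_
  · intro y _
    by_cases hadm : ∀ e, e ∉ F → y e = z e
    · rw [if_pos hadm, if_pos ((hagree y).2 hadm), A3InactiveTyped.flipOn_flipOn, hswap]; ring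
    · rw [if_neg hadm, if_neg (fun h => hadm ((hagree y).1 h))]; ring
  · intro y _ hne hfix
    apply hne
    by_cases hadm : ∀ e, e ∉ F → y e = z e
    · rw [if_pos hadm, hfix, hdiag]
    · rw [if_neg hadm]
  · intro y _; exact Finset.mem_univ _
  · intro y _; exact A3InactiveTyped.flipOn_flipOn F y

/-- The spectator count vanishes. -/
lemma pairCount_foldK0 (ends : E → Sym2 V) (a₁ a₂ o : V) (F : Finset E) (z : Config E) :
    pairCount F z (foldK0 ends a₁ a₂ o : Config E → Config E → R) = 0 :=
  pairCount_eq_zero_of_antisymm F z _ (foldK0_swap ends a₁ a₂ o) (foldK0_diag ends a₁ a₂ o)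

end Kernels

end TB14Cut

end Summit.Ventures.PercRepro2
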